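import Literature.GroupTheory.Abelian.CyclicAndQuasicyclicCharacterizations
import Literature.NumberTheory.IwasawaTheory.PruferPontryaginDual
import Mathlib.Data.ZMod.QuotientGroup
import HarnessLib

/-!
# Uniqueness of the Prüfer group in COCYCLIC dress: a `p`-primary group whose `p^k`-torsion is cyclic of order `p^k`
# for every `k` is `≅ Z(p^∞)`, and `≅ ℚ_p/ℤ_p` (Kaplansky §9 Exercise 23 applied; all PROVED, no named fact)

Kaplansky, *Infinite Abelian Groups*, §9 Exercise 23 (tree: `Purity.exists_addEquiv_prufer_of_forall_ne_top_finite`): an infinite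
group all of whose proper subgroups are finite is `≅ Z(p^∞)` for some prime `p`. The form in which the arithmetic files of the tree
DELIVER a Prüfer group is different — «`M` is `p`-primary and for every `k` its `p^k`-torsion is cyclic, generated by an element of
order `p^k`» (e.g. a CM summand `E[𝔭^∞]`: cell `bsd-print-cf2`'s `cmPrimary_structure_two`, conjuncts 4–5; Keller–Yin's `(F/𝓞)(θ)`;
the tree's `QpModZp p = ℚ_p/ℤ_p` with its generators `tgen p k`). This file bridges the two:

* `Cocyclic.infinite`, `Cocyclic.finite_of_ne_top` — such an `M` is infinite and every proper subgroup is finite;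
* **`Cocyclic.nonempty_addEquiv_prufer`** — `M ≃+ Z(p^∞)` (`= AddCommGroup.primaryComponent (AddCircle (1 : ℚ)) p`, the SAME `p`);
* `QpModZp.addOrderOf_tgen`, `QpModZp.mem_zmultiples_tgen_of_nsmul_eq_zero` — `ℚ_p/ℤ_p` is cocyclic in this sense;
* **`Cocyclic.nonempty_addEquiv_qpModZp`** — hence `M ≃+ ℚ_p/ℤ_p`; **`Cocyclic.nonempty_addEquiv`** — any two such groups are isomorphic.

Consumer (cell `bsd-print-cf2`, crux stmt-BirchSwinnertonDyer-20368, S3b′ twist step): an additive identification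
`W* = W[v̄^∞] ≃+ charModule ∅ θ` (both cocyclic `2`-primary; `charModuleEquiv : charModule ∅ θ ≃+ QpModZp p`), the input `φ` of
`CharTwist.exists_dualData₂_of_scalarChar`. No named fact, no `sorry`, no `instance`, no notation, no new definition.

## References

* [Kaplansky1954] I. Kaplansky, *Infinite Abelian Groups* (1954), §9 Exercise 23 (PDF p. 24); §4 (structure of `Z(p^∞)`).
* [Hungerford1974] T. Hungerford, *Algebra*, Ch. I §3 Exercise 7 (b), (d) (`Z(p^∞)`: bounded orders ⇒ inside `⟨1/p^k⟩`; the only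
  proper subgroups are the `⟨1/pⁿ⟩`).
-/

noncomputable section

open Literature.NumberTheory.IwasawaTheory

universe u

namespace Literature.GroupTheory.Abelian

namespace Cocyclic

variable {p : ℕ} [hp : Fact p.Prime] {M : Type u} [AddCommGroup M]
  (htors : ∀ x : M, ∃ k : ℕ, p ^ k • x = 0)
  (hcyc : ∀ k : ℕ, ∃ g : M, addOrderOf g = p ^ k ∧ ∀ x : M, p ^ k • x = 0 → x ∈ AddSubgroup.zmultiples g)

include hcyc in
/-- A group with elements of every order `p^k` is infinite. [cite: Kaplansky1954, §9 Exercise 23 (PDF p. 24)] -/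
theorem infinite : Infinite M := by
  classical
  choose g hg using hcyc
  refine Infinite.of_injective g fun i j hij ↦ ?_
  have h := congrArg addOrderOf hij
  rw [(hg i).1, (hg j).1] at h
  exact Nat.pow_right_injective hp.out.two_le h

include htors hcyc in
/-- **Every proper subgroup of a cocyclic `p`-primary group is finite** (if the orders in `H` are bounded by `p^K` then
`H ≤ ⟨g_K⟩`, finite; if they are unbounded, `H` contains a generator of every `M[p^k]`, so `H = M`).
[cite: Hungerford1974, Ch. I §3 Exercise 7 (b), (d) (PDF p. 88)] [cite: Kaplansky1954, §9 Exercise 23 (PDF p. 24)] -/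
theorem finite_of_ne_top (H : AddSubgroup M) (hH : H ≠ ⊤) : (H : Set M).Finite := by
  classical
  by_contra hinf
  apply hH
  -- orders in `H` are unbounded: for every `k` some `h ∈ H` is not killed by `p^k`
  have hunb : ∀ k : ℕ, ∃ h ∈ H, p ^ k • h ≠ 0 := by
    intro k
    by_contra hall
    obtain ⟨g, hg, hgen⟩ := hcyc k
    apply hinf
    have hle : (H : Set M) ⊆ (AddSubgroup.zmultiples g : Set M) := fun h hh ↦
      hgen h (by by_contra hne; exact hall ⟨h, hh, hne⟩)
    have hfin : (AddSubgroup.zmultiples g : Set M).Finite :=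
      finite_zmultiples.mpr (addOrderOf_pos_iff.mp (by rw [hg]; exact pow_pos hp.out.pos _))
    exact hfin.subset hle
  -- hence `H` contains every `M[p^k]`
  rw [eq_top_iff]
  intro x _
  obtain ⟨k, hk⟩ := htors x
  obtain ⟨h, hhH, hh⟩ := hunb k
  -- the order of `h` is `p^j` with `j > k`
  obtain ⟨m, hm⟩ := htors h
  obtain ⟨j, -, hj⟩ := (Nat.dvd_prime_pow hp.out).mp (addOrderOf_dvd_of_nsmul_eq_zero hm)
  have hkj : k < j := by
    refine lt_of_not_ge fun hle ↦ hh ?_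
    have h1 : p ^ j • h = 0 := by rw [← hj]; exact addOrderOf_nsmul_eq_zero h
    obtain ⟨c, rfl⟩ := Nat.exists_eq_add_of_le hle
    rw [pow_add, mul_comm, mul_smul, h1, smul_zero]
  -- `⟨h⟩ = ⟨g_j⟩ = M[p^j]` by cardinality
  obtain ⟨g, hg, hgen⟩ := hcyc j
  have hhg : AddSubgroup.zmultiples h ≤ AddSubgroup.zmultiples g :=
    AddSubgroup.zmultiples_le.mpr (hgen h (by rw [← hj]; exact addOrderOf_nsmul_eq_zero h))
  haveI : Finite (AddSubgroup.zmultiples g) :=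
    (finite_zmultiples.mpr (addOrderOf_pos_iff.mp (by rw [hg]; exact pow_pos hp.out.pos _))).to_subtype
  have heq : AddSubgroup.zmultiples h = AddSubgroup.zmultiples g :=
    AddSubgroup.eq_of_le_of_card_ge hhg (by rw [Nat.card_zmultiples, Nat.card_zmultiples, hg, hj])
  -- `x ∈ M[p^k] ≤ M[p^j] = ⟨g_j⟩ = ⟨h⟩ ≤ H`
  have hxj : p ^ j • x = 0 := by
    obtain ⟨c, rfl⟩ := Nat.exists_eq_add_of_le hkj.le
    rw [pow_add, mul_comm, mul_smul, hk, smul_zero]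
  have hx : x ∈ AddSubgroup.zmultiples h := by rw [heq]; exact hgen x hxj
  exact (AddSubgroup.zmultiples_le.mpr hhH) hx

include htors hcyc in
/-- **UNIQUENESS OF THE PRÜFER GROUP, COCYCLIC FORM**: a `p`-primary group whose `p^k`-torsion is, for every `k`, cyclic on an
element of order `p^k` is isomorphic to `Z(p^∞)` (Kaplansky §9 Exercise 23; the prime is recovered from an element of order `p`).
[cite: Kaplansky1954, §9 Exercise 23 (PDF p. 24)] -/
theorem nonempty_addEquiv_prufer : Nonempty (M ≃+ AddCommGroup.primaryComponent (AddCircle (1 : ℚ)) p) := by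
  haveI : Infinite M := infinite hcyc
  obtain ⟨q, hq, ⟨e⟩⟩ := Purity.exists_addEquiv_prufer_of_forall_ne_top_finite (finite_of_ne_top htors hcyc)
  -- the prime `q` is `p`: an element of order `p` goes to an element of `q`-power order
  haveI : Fact q.Prime := ⟨hq⟩
  obtain ⟨g, hg, -⟩ := hcyc 1
  rw [pow_one] at hg
  obtain ⟨n, hn⟩ := (AddCommGroup.mem_primaryComponent_iff_addOrderOf (G := AddCircle (1 : ℚ)) (p := q)).mp (e g).2
  rw [AddSubgroup.addOrderOf_coe, AddEquiv.addOrderOf_eq, hg] at hn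
  obtain ⟨rfl, -⟩ := (Nat.Prime.pow_eq_iff hp.out).mp hn.symm
  exact ⟨e⟩

end Cocyclic

/-! ### `ℚ_p/ℤ_p` is cocyclic -/

namespace QpModZpCocyclic

variable {p : ℕ} [hp : Fact p.Prime]

/-- `(p : ℤ_p)^k • x = p^k • x` on `ℚ_p/ℤ_p`. [cite: Hungerford1974, Ch. I §3 Exercise 7 (a) (PDF p. 88)] -/
theorem coe_pow_smul_eq_nsmul (k : ℕ) (x : QpModZp p) : ((p : ℤ_[p]) ^ k) • x = p ^ k • x := by
  rw [← Nat.cast_pow, Nat.cast_smul_eq_nsmul]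

/-- **`tgen p k = [p^{-k}]` has order exactly `p^k`.** [cite: Hungerford1974, Ch. I §3 Exercise 7 (d) (PDF p. 88)] -/
theorem addOrderOf_tgen (k : ℕ) : addOrderOf (QpModZp.tgen p k) = p ^ k := by
  cases k with
  | zero => rw [QpModZp.tgen_zero, pow_zero, addOrderOf_zero]
  | succ k =>
    refine addOrderOf_eq_prime_pow (fun h ↦ ?_) (QpModZp.pow_nsmul_tgen (k + 1))
    rw [← coe_pow_smul_eq_nsmul, add_comm, QpModZp.pow_smul_tgen_add] at h
    exact QpModZp.tgen_one_ne_zero h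

/-- **Every `p^k`-torsion element of `ℚ_p/ℤ_p` is an integer multiple of `tgen p k`** («bounded orders `≤ p^k` ⇒ inside `⟨1/p^k⟩`»).
[cite: Hungerford1974, Ch. I §3 Exercise 7 (b) (PDF p. 88)] -/
theorem mem_zmultiples_tgen_of_nsmul_eq_zero {k : ℕ} {x : QpModZp p} (hx : p ^ k • x = 0) :
    x ∈ AddSubgroup.zmultiples (QpModZp.tgen p k) := by
  obtain ⟨n, m, rfl⟩ := QpModZp.exists_eq_nsmul_tgen x
  rcases le_or_gt n k with hnk | hkn
  · -- `tgen n = p^{k-n} • tgen k`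
    obtain ⟨c, rfl⟩ := Nat.exists_eq_add_of_le hnk
    have h : QpModZp.tgen p n = p ^ c • QpModZp.tgen p (n + c) := by
      rw [← coe_pow_smul_eq_nsmul, QpModZp.pow_smul_tgen_add]
    rw [h, ← mul_nsmul]
    exact AddSubgroup.nsmul_mem _ (AddSubgroup.mem_zmultiples _) _
  · -- `n = k + j + 1`: `p^k • m • tgen n = 0` forces `p^(j+1) ∣ m`
    obtain ⟨j, rfl⟩ := Nat.exists_eq_add_of_lt hkn
    have h0 : (((m * p ^ k : ℕ) : ℤ) : ℤ_[p]) • QpModZp.tgen p (k + j + 1) = 0 := by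
      rw [Int.cast_smul_eq_zsmul, natCast_zsmul, mul_comm, mul_smul, hx]
    rw [QpModZp.smul_tgen_eq_zero_iff, Ideal.mem_span_singleton, PadicInt.pow_p_dvd_int_iff] at h0
    have h1 : (p : ℤ) ^ (j + 1) ∣ (m : ℤ) := by
      have hpk : (p : ℤ) ^ k ≠ 0 := pow_ne_zero _ (Nat.cast_ne_zero.mpr hp.out.ne_zero)
      rw [Nat.cast_mul, Nat.cast_pow, show k + j + 1 = k + (j + 1) by ring, pow_add, mul_comm (m : ℤ)] at h0
      exact (mul_dvd_mul_iff_left hpk).mp h0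
    obtain ⟨m', hm'⟩ : p ^ (j + 1) ∣ m := by exact_mod_cast h1
    rw [hm', mul_comm, mul_smul, ← coe_pow_smul_eq_nsmul, show k + j + 1 = k + (j + 1) by ring,
      QpModZp.pow_smul_tgen_add]
    exact AddSubgroup.nsmul_mem _ (AddSubgroup.mem_zmultiples _) _

/-- `ℚ_p/ℤ_p` is cocyclic: for every `k` an element of order `p^k` generating the `p^k`-torsion.
[cite: Hungerford1974, Ch. I §3 Exercise 7 (b), (d) (PDF p. 88)] -/
theorem cocyclic (k : ℕ) : ∃ g : QpModZp p, addOrderOf g = p ^ k ∧ ∀ x : QpModZp p, p ^ k • x = 0 →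
    x ∈ AddSubgroup.zmultiples g :=
  ⟨QpModZp.tgen p k, addOrderOf_tgen k, fun _ hx ↦ mem_zmultiples_tgen_of_nsmul_eq_zero hx⟩

/-- `ℚ_p/ℤ_p ≅ Z(p^∞)`. [cite: Kaplansky1954, §9 Exercise 23 (PDF p. 24)] -/
theorem nonempty_addEquiv_prufer : Nonempty (QpModZp p ≃+ AddCommGroup.primaryComponent (AddCircle (1 : ℚ)) p) :=
  Cocyclic.nonempty_addEquiv_prufer QpModZp.exists_pow_nsmul_eq_zero cocyclic

end QpModZpCocyclic

namespace Cocyclic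

variable {p : ℕ} [hp : Fact p.Prime] {M : Type u} [AddCommGroup M]
  (htors : ∀ x : M, ∃ k : ℕ, p ^ k • x = 0)
  (hcyc : ∀ k : ℕ, ∃ g : M, addOrderOf g = p ^ k ∧ ∀ x : M, p ^ k • x = 0 → x ∈ AddSubgroup.zmultiples g)

include htors hcyc in
/-- **A cocyclic `p`-primary group is `≅ ℚ_p/ℤ_p`.** [cite: Kaplansky1954, §9 Exercise 23 (PDF p. 24)] -/
theorem nonempty_addEquiv_qpModZp : Nonempty (M ≃+ QpModZp p) := by
  obtain ⟨e₁⟩ := nonempty_addEquiv_prufer htors hcyc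
  obtain ⟨e₂⟩ := QpModZpCocyclic.nonempty_addEquiv_prufer (p := p)
  exact ⟨e₁.trans e₂.symm⟩

include htors hcyc in
/-- **Any two cocyclic `p`-primary groups are isomorphic.** [cite: Kaplansky1954, §9 Exercise 23 (PDF p. 24)] -/
theorem nonempty_addEquiv {M' : Type u} [AddCommGroup M'] (htors' : ∀ x : M', ∃ k : ℕ, p ^ k • x = 0)
    (hcyc' : ∀ k : ℕ, ∃ g : M', addOrderOf g = p ^ k ∧ ∀ x : M', p ^ k • x = 0 → x ∈ AddSubgroup.zmultiples g) :
    Nonempty (M ≃+ M') := by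
  obtain ⟨e₁⟩ := nonempty_addEquiv_prufer htors hcyc
  obtain ⟨e₂⟩ := nonempty_addEquiv_prufer htors' hcyc'
  exact ⟨e₁.trans e₂.symm⟩

end Cocyclic

end Literature.GroupTheory.Abelian

end
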